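import Summits.Ventures.KdS.AtlasWave1
import Summits.Ventures.KdS.WindowConstantsB0
import Literature.Geometry.Lorentzian.KerrDeSitterPartialModeStabilityNonzeroFreq
import HarnessLib

/-!
# pub-kds venture — rebinding the substrate on the corrected cited fact
# `CasalsTeixeiraDaCosta2022_theorem310` (cell ruling A60, audit `H1H3-AS-PRINTED.md` delta D-ω0)

HONEST FRAMING. This file adds `_310` TWINS of the thirteen substrate theorems of
`ModeStability.lean`, `ModeStabilityB0.lean`, `WindowConstantsB0.lean` and `AtlasWave1.lean` that bind
the cited fact (H1). The landed binder `CasalsTeixeiraDaCosta2022_partialModeStability`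
(Casals–Teixeira da Costa 2022, Thm 3.10, as first vendored) omits the printed standing hypothesis
`ω ≠ 0` (their Def. 3.4) and is refutable at `(s, ω, m) = (0, 0, 0)`, so every theorem binding it is
vacuous as a conditional; the corrected fact `CasalsTeixeiraDaCosta2022_theorem310`
(`Literature/Geometry/Lorentzian/KerrDeSitterPartialModeStabilityNonzeroFreq.lean`) carries `ω ≠ 0`.
Nothing else changes: the window tables, window constants (H4), the angular sign (H2, proved), the ray
fact (H3), the certificates (DATA) and every argument are the landed ones — all `Im ω > 0` reasoning
only ever used bullet 1 of Thm 3.10, whose window form (`….window`) has the SAME statement for both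
facts. The originals stay in the tree untouched; the paper and App. A cite the `_310` twins.

Design (ruling A60 (i)): the two theorems whose proofs actually invoke the fact, `statementA_of` and
`statementAScalar_of`, are factored ONCE through the bullet-1 WINDOW STATEMENT as an explicit
hypothesis (`statementA_ofWindow`, `statementAScalar_ofWindow`; bodies copied verbatim from
`ModeStability.lean`), so the real-axis disjunct of Thm 3.10 never enters the open-half-plane chain
and a future re-vendoring of the fact costs one line; every other twin is a one-liner over these.
No new definitions, no facts, 0 sorries. Namespace `Summit.Ventures.KdS`.
-/

noncomputable section

open Set Complex

namespace Summit.Ventures.KdS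

open Literature.Geometry.Lorentzian Literature.Geometry.Lorentzian.KerrDeSitter

/-! ### The bullet-1 window statement as an explicit hypothesis -/

/-- COVERAGE for `s = -2` from the WINDOW FORM of Casals–Teixeira da Costa's Thm 3.10, bullet 1
(stated verbatim as the hypothesis `hW`; it is `CasalsTeixeiraDaCosta2022_theorem310.window h1`),
the angular sign (H2), the ray fact (H3) and the window constants (H4). Body = `statementA_of`. -/
theorem statementA_ofWindow {B : Set (ℝ × ℝ × ℝ)} {T : WindowTable}
    (hW : ∀ {M a Λ s : ℝ} {ω : ℂ} {m : ℝ} {lam : ℂ}, IsSubextremal M a Λ → 0 ≤ a → |a| < 3 / Λ →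
      a ^ 2 < 3 / Λ → (∃ k : ℤ, 2 * s = k) → (∃ k : ℤ, m - s = k) → 0 < ω.im →
      (lambdaBar a Λ s ω m lam * (starRingEnd ℂ) ω).im ≤ 0 →
      (ω.re ≠ m * horizonAngVel a (rPlus M a Λ) ∨ s ≤ 0) →
      (ω.re ≠ m * horizonAngVel a (rCosmo M a Λ) ∨ 0 ≤ s) → ∀ {R : ℝ → ℂ},
      IsRadialTeukolskySolution M a Λ s ω m lam R → IsIngoingAtEventHorizon M a Λ s ω m R →
      IsOutgoingAtCosmoHorizon M a Λ ω m R → (∃ r ∈ Ioo (rPlus M a Λ) (rCosmo M a Λ), R r ≠ 0) →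
      0 < ‖ω‖ ∧ ‖ω‖ < |m| * superradiantUpper M a Λ)
    (h2 : CasalsTeixeiraDaCosta2022_angularSign)
    (h3 : CasalsTeixeiraDaCosta2022_partialModeStabilityProp38) (h4 : WindowConstants B T) :
    StatementA B T := by
  intro p hp ω m hq hk hmode
  obtain ⟨hIm, hm2, hnotW⟩ := hq
  obtain ⟨lam, R, hang, hrad, hin, hout, hnt⟩ := hmode
  obtain ⟨hsub, hapos, haL, haL2, ⟨hk0, hk1, hk2pos, hk10⟩, hkap, hconst⟩ := h4 p hp
  obtain ⟨hΩ, hΩH, hϖ⟩ := hconst m hm2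
  have ha : 0 ≤ p.2.1 := hapos.le
  have hs : ∃ k : ℤ, 2 * (-2 : ℝ) = k := ⟨-4, by norm_num⟩
  have hlam := (h2 _ _ _ _ _ _ hsub.2.1 hapos hs hk hIm hang).le
  have hnotW' : |ω.re| ≤ T.R m → T.H < ω.im := by
    intro hre
    by_contra hle
    exact hnotW ⟨hre, hIm, not_lt.mp hle⟩
  have hbig : |m| * superradiantUpper p.1 p.2.1 p.2.2 ≤ ‖ω‖ := by
    by_cases hre : |ω.re| ≤ T.R m
    · calc |m| * superradiantUpper p.1 p.2.1 p.2.2 ≤ T.H := hΩH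
        _ ≤ ω.im := le_of_lt (hnotW' hre)
        _ ≤ |ω.im| := le_abs_self _
        _ ≤ ‖ω‖ := Complex.abs_im_le_norm ω
    · calc |m| * superradiantUpper p.1 p.2.1 p.2.2 ≤ T.R m := hΩ
        _ ≤ |ω.re| := le_of_lt (not_le.mp hre)
        _ ≤ ‖ω‖ := Complex.abs_re_le_norm ω
  by_cases hray : ω.re = m * horizonAngVel p.2.1 (rCosmo p.1 p.2.1 p.2.2)
  · have hre : |ω.re| ≤ T.R m := by rw [hray]; exact hϖ
    have hk2 : kappaCosmo p.1 p.2.1 p.2.2 < ω.im := lt_of_le_of_lt hkap (hnotW' hre)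
    have hm' : ∃ k : ℤ, m + 2 = k := by
      obtain ⟨k, hk'⟩ := hk
      exact ⟨k, by linarith⟩
    have hw := CasalsTeixeiraDaCosta2022_partialModeStabilityProp38.cosmoRay_negTwo h3 hsub ha haL hm'
      hk0 hk1 hk2pos hk10 hray hk2 hlam hrad hin hout hnt
    exact absurd hw.2 (not_lt.mpr hbig)
  · have hw := hW hsub ha haL haL2 hs hk hIm hlam (Or.inr (by norm_num)) (Or.inl hray) hrad hin hout hnt
    exact absurd hw.2 (not_lt.mpr hbig)

/-- COVERAGE, scalar table (`s = 0`, `μ = 1`), from the WINDOW FORM of Thm 3.10 bullet 1 (`hW`), (H2),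
(H4), (H4s). Body = `statementAScalar_of`. -/
theorem statementAScalar_ofWindow {B : Set (ℝ × ℝ × ℝ)} {T : WindowTable}
    (hW : ∀ {M a Λ s : ℝ} {ω : ℂ} {m : ℝ} {lam : ℂ}, IsSubextremal M a Λ → 0 ≤ a → |a| < 3 / Λ →
      a ^ 2 < 3 / Λ → (∃ k : ℤ, 2 * s = k) → (∃ k : ℤ, m - s = k) → 0 < ω.im →
      (lambdaBar a Λ s ω m lam * (starRingEnd ℂ) ω).im ≤ 0 →
      (ω.re ≠ m * horizonAngVel a (rPlus M a Λ) ∨ s ≤ 0) →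
      (ω.re ≠ m * horizonAngVel a (rCosmo M a Λ) ∨ 0 ≤ s) → ∀ {R : ℝ → ℂ},
      IsRadialTeukolskySolution M a Λ s ω m lam R → IsIngoingAtEventHorizon M a Λ s ω m R →
      IsOutgoingAtCosmoHorizon M a Λ ω m R → (∃ r ∈ Ioo (rPlus M a Λ) (rCosmo M a Λ), R r ≠ 0) →
      0 < ‖ω‖ ∧ ‖ω‖ < |m| * superradiantUpper M a Λ)
    (h2 : CasalsTeixeiraDaCosta2022_angularSign)
    (h4 : WindowConstants B T) (h4s : WindowConstantsScalar B T) : StatementAScalar B T := by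
  intro p hp ω m hq hk hmode
  obtain ⟨hIm, hm2, hnotW⟩ := hq
  obtain ⟨lam, R, hang, hrad, hin, hout, hnt⟩ := hmode
  obtain ⟨hsub, hapos, haL, haL2, _hks, _hkap, hconst⟩ := h4 p hp
  obtain ⟨hΩ, _hΩH, _hϖ⟩ := hconst m hm2
  have ha : 0 ≤ p.2.1 := hapos.le
  have hs : ∃ k : ℤ, 2 * (0 : ℝ) = k := ⟨0, by norm_num⟩
  have hlam := (h2 _ _ _ _ _ _ hsub.2.1 hapos hs hk hIm hang).le
  have hw := hW hsub ha haL haL2 hs hk hIm hlam (Or.inr le_rfl) (Or.inr le_rfl) hrad hin hout hnt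
  by_cases hm0 : m = 0
  · have h0 : ‖ω‖ < 0 := by simpa [hm0] using hw.2
    exact (not_lt.mpr (norm_nonneg ω)) h0
  · have hh := h4s p hp m hm2 hm0
    have hnotW' : |ω.re| ≤ T.R m → T.h0 m < ω.im := by
      intro hre
      by_contra hle
      exact hnotW ⟨hm0, hre, hIm, not_lt.mp hle⟩
    have hbig : |m| * superradiantUpper p.1 p.2.1 p.2.2 ≤ ‖ω‖ := by
      by_cases hre : |ω.re| ≤ T.R m
      · calc |m| * superradiantUpper p.1 p.2.1 p.2.2 ≤ T.h0 m := hh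
          _ ≤ ω.im := le_of_lt (hnotW' hre)
          _ ≤ |ω.im| := le_abs_self _
          _ ≤ ‖ω‖ := Complex.abs_im_le_norm ω
      · calc |m| * superradiantUpper p.1 p.2.1 p.2.2 ≤ T.R m := hΩ
          _ ≤ |ω.re| := le_of_lt (not_le.mp hre)
          _ ≤ ‖ω‖ := Complex.abs_re_le_norm ω
    exact absurd hw.2 (not_lt.mpr hbig)

/-! ### `ModeStability.lean` twins on the corrected fact -/

/-- `statementA_of` on the corrected fact (H1 = Casals–Teixeira da Costa 2022 Thm 3.10 WITH `ω ≠ 0`). -/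
theorem statementA_of_310 {B : Set (ℝ × ℝ × ℝ)} {T : WindowTable}
    (h1 : CasalsTeixeiraDaCosta2022_theorem310) (h2 : CasalsTeixeiraDaCosta2022_angularSign)
    (h3 : CasalsTeixeiraDaCosta2022_partialModeStabilityProp38) (h4 : WindowConstants B T) :
    StatementA B T :=
  statementA_ofWindow (fun hsub ha haL haL2 hs hm hω hlam hr1 hr2 _ hR hin hout hnt =>
    h1.window hsub ha haL haL2 hs hm hω hlam hr1 hr2 hR hin hout hnt) h2 h3 h4

/-- `msTrunc_of_facts` on the corrected fact. -/
theorem msTrunc_of_facts_310 {B : Set (ℝ × ℝ × ℝ)} {T : WindowTable} {Λs : ℝ → ℝ → ℂ → ℝ → Set ℂ}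
    (h1 : CasalsTeixeiraDaCosta2022_theorem310) (h2 : CasalsTeixeiraDaCosta2022_angularSign)
    (h3 : CasalsTeixeiraDaCosta2022_partialModeStabilityProp38) (h4 : WindowConstants B T)
    (hB : StatementB B T Λs) : MSTrunc B T Λs :=
  msTrunc_of (statementA_of_310 h1 h2 h3 h4) hB

/-- `msTrunc_of_facts'` on the corrected fact ((H2) discharged by
`CasalsTeixeiraDaCosta2022_angularSign_holds`). -/
theorem msTrunc_of_facts'_310 {B : Set (ℝ × ℝ × ℝ)} {T : WindowTable}
    {Λs : ℝ → ℝ → ℂ → ℝ → Set ℂ} (h1 : CasalsTeixeiraDaCosta2022_theorem310)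
    (h3 : CasalsTeixeiraDaCosta2022_partialModeStabilityProp38) (h4 : WindowConstants B T)
    (hB : StatementB B T Λs) : MSTrunc B T Λs :=
  msTrunc_of_facts_310 h1 CasalsTeixeiraDaCosta2022_angularSign_holds h3 h4 hB

/-- `statementAScalar_of` on the corrected fact. -/
theorem statementAScalar_of_310 {B : Set (ℝ × ℝ × ℝ)} {T : WindowTable}
    (h1 : CasalsTeixeiraDaCosta2022_theorem310) (h2 : CasalsTeixeiraDaCosta2022_angularSign)
    (h4 : WindowConstants B T) (h4s : WindowConstantsScalar B T) : StatementAScalar B T :=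
  statementAScalar_ofWindow (fun hsub ha haL haL2 hs hm hω hlam hr1 hr2 _ hR hin hout hnt =>
    h1.window hsub ha haL haL2 hs hm hω hlam hr1 hr2 hR hin hout hnt) h2 h4 h4s

/-- `msTruncScalar_of_facts` on the corrected fact. -/
theorem msTruncScalar_of_facts_310 {B : Set (ℝ × ℝ × ℝ)} {T : WindowTable}
    {Λs : ℝ → ℝ → ℂ → ℝ → Set ℂ}
    (h1 : CasalsTeixeiraDaCosta2022_theorem310) (h2 : CasalsTeixeiraDaCosta2022_angularSign)
    (h4 : WindowConstants B T) (h4s : WindowConstantsScalar B T) (hB : StatementBScalar B T Λs) :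
    MSTruncScalar B T Λs :=
  msTruncScalar_of (statementAScalar_of_310 h1 h2 h4 h4s) hB

/-- `msTruncScalar_of_facts'` on the corrected fact ((H2) discharged). -/
theorem msTruncScalar_of_facts'_310 {B : Set (ℝ × ℝ × ℝ)} {T : WindowTable}
    {Λs : ℝ → ℝ → ℂ → ℝ → Set ℂ} (h1 : CasalsTeixeiraDaCosta2022_theorem310)
    (h4 : WindowConstants B T) (h4s : WindowConstantsScalar B T) (hB : StatementBScalar B T Λs) :
    MSTruncScalar B T Λs :=
  msTruncScalar_of_facts_310 h1 CasalsTeixeiraDaCosta2022_angularSign_holds h4 h4s hB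

/-! ### `ModeStabilityB0.lean` / `WindowConstantsB0.lean` twins -/

/-- `b0Theorem_of` on the corrected fact: the B0 box theorem from H1 (Thm 3.10 with `ω ≠ 0`), H2, H3,
rung R2 and rung R3. -/
theorem b0Theorem_of_310 (h1 : CasalsTeixeiraDaCosta2022_theorem310)
    (h2 : CasalsTeixeiraDaCosta2022_angularSign)
    (h3 : CasalsTeixeiraDaCosta2022_partialModeStabilityProp38)
    (hR2 : R2_WindowConstantsB0) (hR3 : R3_B0Certificates) : B0Theorem :=
  ⟨msTrunc_of_facts_310 h1 h2 h3 hR2.1 (statementB_of_bar (by norm_num) hR3.1),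
    msTruncScalar_of_facts_310 h1 h2 hR2.1 hR2.2 (statementBScalar_of_bar (by norm_num) hR3.2)⟩

/-- `b0Theorem_of'` on the corrected fact ((H2) discharged). -/
theorem b0Theorem_of'_310 (h1 : CasalsTeixeiraDaCosta2022_theorem310)
    (h3 : CasalsTeixeiraDaCosta2022_partialModeStabilityProp38)
    (hR2 : R2_WindowConstantsB0) (hR3 : R3_B0Certificates) : B0Theorem :=
  b0Theorem_of_310 h1 CasalsTeixeiraDaCosta2022_angularSign_holds h3 hR2 hR3

/-- `msTruncB0_tubes` on the corrected fact (eng-1's tube records, `s = -2`). -/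
theorem msTruncB0_tubes_310 (lamHat : ℕ → ℂ → ℝ → ℝ → ℂ)
    (h1 : CasalsTeixeiraDaCosta2022_theorem310) (h2 : CasalsTeixeiraDaCosta2022_angularSign)
    (h3 : CasalsTeixeiraDaCosta2022_partialModeStabilityProp38) (h4 : WindowConstants B0 tableB0)
    (hB : StatementB B0 tableB0 (tubesB0 lamHat)) : MSTrunc B0 tableB0 (tubesB0 lamHat) :=
  msTrunc_of_facts_310 h1 h2 h3 h4 hB

/-- **THE B0 BOX THEOREM FROM THE CERTIFICATES, on the corrected fact**: with (H2) proved and rung R2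
proved (`r2_windowConstantsB0`), `B0Theorem` follows from H1 = Casals–Teixeira da Costa 2022 Thm 3.10
(with its standing hypothesis `ω ≠ 0`), H3 (their Prop. 3.8 on the cosmological threshold ray) and the
signed certificates R3 alone. Twin of `b0Theorem_of_certificates`. -/
theorem b0Theorem_of_certificates_310 (h1 : CasalsTeixeiraDaCosta2022_theorem310)
    (h3 : CasalsTeixeiraDaCosta2022_partialModeStabilityProp38) (hR3 : R3_B0Certificates) :
    B0Theorem :=
  b0Theorem_of'_310 h1 h3 r2_windowConstantsB0 hR3

/-! ### `AtlasWave1.lean` twins -/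

section Wave

variable {ts : List CertTile}

/-- `msTrunc_atlas` on the corrected fact: MS_trunc (`s = -2`) on every tile of the wave. -/
theorem msTrunc_atlas_310 (hWC : ∀ t ∈ ts, WindowConstants t.tile.box t.T) (hη : ∀ t ∈ ts, 0 ≤ t.eta)
    (h1 : CasalsTeixeiraDaCosta2022_theorem310)
    (h3 : CasalsTeixeiraDaCosta2022_partialModeStabilityProp38) (hdata : ∀ t ∈ ts, t.Data) :
    ∀ t ∈ ts, MSTrunc t.tile.box t.T t.lam :=
  fun t ht => msTrunc_of_facts'_310 h1 h3 (hWC t ht)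
    (statementB_of_bar (hη t ht) (t.statementBbar (hdata t ht)))

/-- `msTruncScalar_atlas` on the corrected fact: scalar MS_trunc (`s = 0`, `μ = 1`) on every tile. -/
theorem msTruncScalar_atlas_310 (hWC : ∀ t ∈ ts, WindowConstants t.tile.box t.T)
    (hWCs : ∀ t ∈ ts, WindowConstantsScalar t.tile.box t.T) (hη : ∀ t ∈ ts, 0 ≤ t.eta)
    (h1 : CasalsTeixeiraDaCosta2022_theorem310) (hdata : ∀ t ∈ ts, t.DataScalar) :
    ∀ t ∈ ts, MSTruncScalar t.tile.box t.T t.lamScalar :=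
  fun t ht => msTruncScalar_of_facts'_310 h1 (hWC t ht) (hWCs t ht)
    (statementBScalar_of_bar (hη t ht) (t.statementBbarScalar (hdata t ht)))

/-- **The displayed wave theorem, pointwise form (`s = -2`), on the corrected fact.** For every
parameter point of the atlas there is a tile of the list containing it on which every mode with
`Im ω > 0`, `|m| ≤ 2` has `ω` in the tile's window `W(m)` only if its separation constant lies outside
the tile's (symmetrised) λ-family — given H1 = Casals–Teixeira da Costa 2022 Thm 3.10 (with `ω ≠ 0`),
H3, the kernel-checked window constants and the certificates' DATA. Twin of `noMode_atlas`. -/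
theorem noMode_atlas_310 (hWC : ∀ t ∈ ts, WindowConstants t.tile.box t.T) (hη : ∀ t ∈ ts, 0 ≤ t.eta)
    (h1 : CasalsTeixeiraDaCosta2022_theorem310)
    (h3 : CasalsTeixeiraDaCosta2022_partialModeStabilityProp38) (hdata : ∀ t ∈ ts, t.Data) :
    ∀ p ∈ atlas ts, ∃ t ∈ ts, p ∈ t.tile.box ∧
      NoModeWith p.1 p.2.1 p.2.2 (-2) {q | 0 < q.1.im ∧ |q.2| ≤ 2}
        (fun ω m => {lam | ω ∈ window t.T m → lam ∈ t.lam p.2.1 p.2.2 ω m}) := by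
  rintro p ⟨t, ht, hp⟩
  exact ⟨t, ht, hp, msTrunc_atlas_310 hWC hη h1 h3 hdata t ht p hp⟩

end Wave

end Summit.Ventures.KdS

end
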